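import Literature.Geometry.Symplectic.SteinSeamConformal
import Literature.Geometry.Symplectic.SteinSeamForms
import HarnessLib

/-!
# The twisting number of a framed Legendrian knot is invariant under seam transport

Topic `Literature/Geometry/Symplectic`.  Let a closed `4`-manifold `X` be bisected into two
compact Stein domains, `X = e₁(W₁) ∪ e₂(W₂)`, by smooth embeddings whose images meet exactly
along the images of both boundaries, `range e₁ ∩ range e₂ = e₁(∂W₁) = e₂(∂W₂)`, and whose
pushed-forward complex tangencies `deᵢ(ξᵢ)`, `ξᵢ = T∂Wᵢ ∩ Jᵢ T∂Wᵢ` (`contactPlane`), agree at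
common points.  A Legendrian knot `β ⊂ ∂W₂` with a framing `ν₂` is transported across the seam
to `Λ = e₁⁻¹ ∘ e₂ ∘ β ⊂ ∂W₁` with the framing `ν₁ = de₁⁻¹ de₂ ν₂`.  **Then the twisting numbers
of the two framings relative to the respective canonical (contact) framings agree**,
`twisting Λ ν₁ = twisting β ν₂` (`twisting_eq_of_seamTransport`): the twisting number
(Gompf 1998, §1: framings of a Legendrian knot are measured against *"a canonical framing of
its normal bundle … induced by any vector field transverse to `ξ`"*; Geiges 2008, Def. 3.5.4)
is an invariant of the contact structure near the knot, and the seam map is a contactomorphism.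

Proof (this file assembles `SteinSeamConformal.lean` and `SteinSeamForms.lean`):

* `exists_seamPartner` — on a boundary datum `b₁` of `W₁` (`nonempty_boundaryData_holds`) the
  seam partner `g = e₂⁻¹ ∘ e₁ ∘ incl₁ : b₁.carrier → W₂` of the inclusion is smooth with values
  in `∂W₂` (`ContMDiff.iff_comp_isImmersion`; Lee 2013, Thm. 5.29);
* `exists_seam_conformalFactor` — matched vectors lie in the contact planes simultaneously
  (`mem_contactPlane_iff_of_seamMatching`), so the pulled-back contact forms `incl₁^*α₁`, `g^*α₂` on
  the boundary `3`-manifold have the same kernel, and (`exists_conformalFactor_of_ker_eq`) are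
  related by a continuous nowhere-zero **conformal factor** `F`, with `g^*ω₂ = F · incl₁^*ω₁` on
  kernel pairs (naturality of `d`, `dαᵢ = ωᵢ`);
* `seam_transport_apply` — the same read back at a seam point on matched vectors;
* `twisting_eq_of_seamTransport` — along the knot `F` has constant sign (intermediate value
  theorem on the lifted knot), and `twisting_eq_of_seamTransport_of_conformalFactor`
  (`SteinSeamConformal.lean`) gives the equality of the winding numbers.

The cover `range e₁ ∪ range e₂ = univ` is not used, and no orientation enters: whether the seam
map preserves or reverses the co-orientations (sign of `F`), it preserves rotation numbers
relative to the contact framing.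

## References

* R. E. Gompf, *Handlebody construction of Stein surfaces*, Ann. of Math. 148 (1998), §1.
  [Gompf1998]
* H. Geiges, *An Introduction to Contact Topology*, CUP (2008), Def. 2.1.5, Def. 3.5.4.
  [Geiges2008]
* J. M. Lee, *Introduction to Smooth Manifolds*, 2nd ed. (2013), Thm. 5.29.
  [LeeSmoothManifolds2013]
-/

noncomputable section

open scoped Manifold ContDiff Topology
open Set Function Filter

namespace Literature.Geometry.Symplectic

open Literature.Geometry.Kaehler Literature.Topology.FourManifolds Literature.Topology.PlaneTopology

/-- The model vector space `ℝ³` of the boundary `3`-manifolds. [folklore] -/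
local notation "E3" => EuclideanSpace ℝ (Fin 3)

/-- The model vector space `ℝ⁴` of the tangent spaces. [folklore] -/
local notation "E4" => EuclideanSpace ℝ (Fin 4)

/-- Local notation: `𝕊 n` is the unit sphere in `EuclideanSpace ℝ (Fin (n + 1))`. -/
local notation "𝕊 " n:arg => (Metric.sphere (0 : EuclideanSpace ℝ (Fin (n + 1))) 1)

/-! ### The seam partner of the boundary inclusion -/

section SeamMap

variable {X : Type*} [TopologicalSpace X] [ChartedSpace (EuclideanSpace ℝ (Fin 4)) X]
  {W₁ : Type*} [TopologicalSpace W₁] [ChartedSpace (EuclideanHalfSpace 4) W₁]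
  {W₂ : Type*} [TopologicalSpace W₂] [ChartedSpace (EuclideanHalfSpace 4) W₂]

/-- **The seam partner of the boundary inclusion.**  Let `e₁ : W₁ → X`, `e₂ : W₂ → X` be smooth
embeddings whose images meet exactly along the images of both boundaries.  For a boundary datum
`b₁` of `W₁` there is a smooth map `g : b₁.carrier → W₂` with `e₂ ∘ g = e₁ ∘ incl₁`, taking
values in `∂W₂`: set-theoretically `g = e₂⁻¹ ∘ e₁ ∘ incl₁`; it is continuous because `e₂` is a
topological embedding and smooth because a continuous map into the source of an immersion is
smooth iff its composite with the immersion is (Mathlib `ContMDiff.iff_comp_isImmersion`;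
Lee, *Introduction to Smooth Manifolds* (2013), Thm. 5.29). [folklore] -/
theorem exists_seamPartner {e₁ : W₁ → X} {e₂ : W₂ → X}
    (h1 : Manifold.IsSmoothEmbedding (𝓡∂ 4) (𝓡 4) ∞ e₁)
    (h2 : Manifold.IsSmoothEmbedding (𝓡∂ 4) (𝓡 4) ∞ e₂)
    (hL : range e₁ ∩ range e₂ = e₁ '' (𝓡∂ 4).boundary W₁)
    (hR : range e₁ ∩ range e₂ = e₂ '' (𝓡∂ 4).boundary W₂) (b₁ : BoundaryData (𝓡∂ 4) W₁ (𝓡 3)) :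
    ∃ g : b₁.carrier → W₂, ContMDiff (𝓡 3) (𝓡∂ 4) ∞ g ∧ (∀ z, e₂ (g z) = e₁ (b₁.incl z)) ∧
      ∀ z, g z ∈ (𝓡∂ 4).boundary W₂ := by
  -- adapted from the lead's `stub_seam` (crux 3546)
  have hseam : ∀ z : b₁.carrier, e₁ (b₁.incl z) ∈ range e₁ ∩ range e₂ := fun z => by
    rw [hL]
    exact ⟨b₁.incl z, b₁.incl_mem_boundary z, rfl⟩
  have hex : ∀ z : b₁.carrier, ∃ w : W₂, e₂ w = e₁ (b₁.incl z) := fun z => (hseam z).2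
  choose g hg using hex
  have hcomp : e₂ ∘ g = e₁ ∘ b₁.incl := funext hg
  have hsmooth : ContMDiff (𝓡 3) (𝓡 4) ∞ (e₁ ∘ b₁.incl) :=
    h1.contMDiff.comp b₁.isSmoothEmbedding.contMDiff
  have hcont : Continuous g := by
    rw [h2.isEmbedding.continuous_iff, hcomp]
    exact hsmooth.continuous
  have hgs : ContMDiff (𝓡 3) (𝓡∂ 4) ∞ g := by
    rw [ContMDiff.iff_comp_isImmersion h2.isImmersion, hcomp]
    exact ⟨hcont, hsmooth⟩
  refine ⟨g, hgs, hg, fun z => ?_⟩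
  have hmem : e₂ (g z) ∈ range e₁ ∩ range e₂ := by
    rw [hg]
    exact hseam z
  rw [hR] at hmem
  obtain ⟨w, hw, hwe⟩ := hmem
  rwa [← h2.isEmbedding.injective hwe]

end SeamMap

section Seam

variable {X : Type*} [TopologicalSpace X] [ChartedSpace (EuclideanSpace ℝ (Fin 4)) X]
  {W₁ : Type*} [TopologicalSpace W₁] [ChartedSpace (EuclideanHalfSpace 4) W₁]
  [IsManifold (𝓡∂ 4) ∞ W₁] [CompactSpace W₁]
  {W₂ : Type*} [TopologicalSpace W₂] [ChartedSpace (EuclideanHalfSpace 4) W₂]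
  [IsManifold (𝓡∂ 4) ∞ W₂] [CompactSpace W₂]

/-- **Matched vectors lie in the contact planes simultaneously.**  If the pushed-forward complex
tangencies of two Stein domains agree at `e₁ w₁ = e₂ w₂` and `de₁`, `de₂` are injective there,
then for `de₁ u₁ = de₂ u₂` one has `u₁ ∈ ξ₁ ↔ u₂ ∈ ξ₂`. [folklore] -/
theorem mem_contactPlane_iff_of_seamMatching (J₁ : SteinStructure W₁) (J₂ : SteinStructure W₂)
    {e₁ : W₁ → X} {e₂ : W₂ → X} {w₁ : W₁} {w₂ : W₂}
    (hC : Submodule.map (mfderiv (𝓡∂ 4) (𝓡 4) e₁ w₁).toLinearMap (contactPlane J₁.J w₁) =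
      Submodule.map (mfderiv (𝓡∂ 4) (𝓡 4) e₂ w₂).toLinearMap (contactPlane J₂.J w₂))
    (hinj₁ : Injective (mfderiv (𝓡∂ 4) (𝓡 4) e₁ w₁))
    (hinj₂ : Injective (mfderiv (𝓡∂ 4) (𝓡 4) e₂ w₂)) {u₁ u₂ : E4}
    (hu : mfderiv (𝓡∂ 4) (𝓡 4) e₁ w₁ u₁ = mfderiv (𝓡∂ 4) (𝓡 4) e₂ w₂ u₂) :
    u₁ ∈ contactPlane J₁.J w₁ ↔ u₂ ∈ contactPlane J₂.J w₂ := by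
  -- adapted from the crux support file `Negative/SeamContacto.lean`
  constructor
  · intro h₁
    have hmem := (SetLike.ext_iff.mp hC _).mp (Submodule.mem_map.2 ⟨_, h₁, rfl⟩)
    obtain ⟨w, hw, hw'⟩ := hmem
    have : w = u₂ := hinj₂ (hw'.trans hu)
    rwa [this] at hw
  · intro h₂
    have hmem := (SetLike.ext_iff.mp hC _).mpr (Submodule.mem_map.2 ⟨_, h₂, rfl⟩)
    obtain ⟨w, hw, hw'⟩ := hmem
    have : w = u₁ := hinj₁ (hw'.trans hu.symm)
    rwa [this] at hw

variable [IsManifold (𝓡 4) ∞ X]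

/-- **Pointwise seam transport of `α` and `ω(ċ, ·)`**, at a seam point written with free base
points (so that the knot points can be substituted): with `F` the conformal factor of
`exists_seam_conformalFactor`, for `incl₁ z = x₁`, `g z = x₂`:
`α₂(u₂) = F z · α₁(u₁)` whenever `u₁ ∈ T∂W₁` and `de₁ u₁ = de₂ u₂`, and
`ω₂(c₂, v₂) = F z · ω₁(c₁, v₁)` whenever `c₁, v₁ ∈ ξ₁`, `de₁ c₁ = de₂ c₂`, `de₁ v₁ = de₂ v₂`
(boundary tangent vectors lift to the boundary manifold, `exists_mfderiv_incl_eq`, and `de₂`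
is injective). [folklore] -/
theorem seam_transport_apply (J₁ : SteinStructure W₁) (J₂ : SteinStructure W₂)
    {e₁ : W₁ → X} {e₂ : W₂ → X} (h1 : Manifold.IsSmoothEmbedding (𝓡∂ 4) (𝓡 4) ∞ e₁)
    (h2 : Manifold.IsSmoothEmbedding (𝓡∂ 4) (𝓡 4) ∞ e₂)
    (b₁ : BoundaryData (𝓡∂ 4) W₁ (𝓡 3)) {g : b₁.carrier → W₂} (hg : ContMDiff (𝓡 3) (𝓡∂ 4) ∞ g)
    (hge : ∀ z, e₂ (g z) = e₁ (b₁.incl z)) {F : b₁.carrier → ℝ}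
    (hFα : ∀ (z : b₁.carrier) (u : E3), J₂.contactForm (g z) (mfderiv (𝓡 3) (𝓡∂ 4) g z u) =
        F z * J₁.contactForm (b₁.incl z) (mfderiv (𝓡 3) (𝓡∂ 4) b₁.incl z u))
    (hFω : ∀ (z : b₁.carrier) (u v : E3),
        mfderiv (𝓡 3) (𝓡∂ 4) b₁.incl z u ∈ contactPlane J₁.J (b₁.incl z) →
        mfderiv (𝓡 3) (𝓡∂ 4) b₁.incl z v ∈ contactPlane J₁.J (b₁.incl z) →
        J₂.kahlerForm (g z) (mfderiv (𝓡 3) (𝓡∂ 4) g z u) (mfderiv (𝓡 3) (𝓡∂ 4) g z v) =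
          F z * J₁.kahlerForm (b₁.incl z) (mfderiv (𝓡 3) (𝓡∂ 4) b₁.incl z u)
            (mfderiv (𝓡 3) (𝓡∂ 4) b₁.incl z v))
    (z : b₁.carrier) {x₁ : W₁} {x₂ : W₂} (hx₁ : b₁.incl z = x₁) (hx₂ : g z = x₂) :
    (∀ u₁ u₂ : E4, u₁ ∈ boundaryTangentSpace →
      mfderiv (𝓡∂ 4) (𝓡 4) e₁ x₁ u₁ = mfderiv (𝓡∂ 4) (𝓡 4) e₂ x₂ u₂ →
      J₂.contactForm x₂ u₂ = F z * J₁.contactForm x₁ u₁) ∧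
    ∀ c₁ c₂ v₁ v₂ : E4, c₁ ∈ contactPlane J₁.J x₁ → v₁ ∈ contactPlane J₁.J x₁ →
      mfderiv (𝓡∂ 4) (𝓡 4) e₁ x₁ c₁ = mfderiv (𝓡∂ 4) (𝓡 4) e₂ x₂ c₂ →
      mfderiv (𝓡∂ 4) (𝓡 4) e₁ x₁ v₁ = mfderiv (𝓡∂ 4) (𝓡 4) e₂ x₂ v₂ →
      J₂.kahlerForm x₂ c₂ v₂ = F z * J₁.kahlerForm x₁ c₁ v₁ := by
  subst hx₁ hx₂
  -- the chain rule along `e₂ ∘ g = e₁ ∘ incl₁` and injectivity of `de₂`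
  have hi : MDifferentiableAt (𝓡 3) (𝓡∂ 4) b₁.incl z :=
    b₁.isSmoothEmbedding.contMDiff.mdifferentiableAt (by simp)
  have hgd : MDifferentiableAt (𝓡 3) (𝓡∂ 4) g z := hg.mdifferentiableAt (by simp)
  have he₁ : MDifferentiableAt (𝓡∂ 4) (𝓡 4) e₁ (b₁.incl z) :=
    h1.contMDiff.mdifferentiableAt (by simp)
  have he₂ : MDifferentiableAt (𝓡∂ 4) (𝓡 4) e₂ (g z) := h2.contMDiff.mdifferentiableAt (by simp)
  have hcomp : e₁ ∘ b₁.incl = e₂ ∘ g := funext fun z => (hge z).symm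
  have hchain : ∀ u : E3, mfderiv (𝓡∂ 4) (𝓡 4) e₁ (b₁.incl z) (mfderiv (𝓡 3) (𝓡∂ 4) b₁.incl z u) =
      mfderiv (𝓡∂ 4) (𝓡 4) e₂ (g z) (mfderiv (𝓡 3) (𝓡∂ 4) g z u) := fun u => by
    rw [← mfderiv_comp_apply z he₁ hi u, hcomp]
    exact mfderiv_comp_apply z he₂ hgd u
  have hinj₂ : Injective (mfderiv (𝓡∂ 4) (𝓡 4) e₂ (g z)) :=
    Manifold.IsImmersionAt.mfderiv_injective (h2.isImmersion.isImmersionAt _) (by simp)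
  -- lifting matched pairs to the boundary manifold
  have hlift : ∀ u₁ u₂ : E4, u₁ ∈ boundaryTangentSpace →
      mfderiv (𝓡∂ 4) (𝓡 4) e₁ (b₁.incl z) u₁ = mfderiv (𝓡∂ 4) (𝓡 4) e₂ (g z) u₂ →
      ∃ w : E3, mfderiv (𝓡 3) (𝓡∂ 4) b₁.incl z w = u₁ ∧ mfderiv (𝓡 3) (𝓡∂ 4) g z w = u₂ := by
    intro u₁ u₂ hu₁ hu
    obtain ⟨w, hw⟩ := exists_mfderiv_incl_eq b₁ z hu₁
    refine ⟨w, hw, hinj₂ ?_⟩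
    rw [← hchain, hw, hu]
  refine ⟨fun u₁ u₂ hu₁ hu => ?_, fun c₁ c₂ v₁ v₂ hc₁ hv₁ hc hv => ?_⟩
  · obtain ⟨w, rfl, rfl⟩ := hlift u₁ u₂ hu₁ hu
    exact hFα z w
  · obtain ⟨w₀, rfl, rfl⟩ := hlift c₁ c₂ (contactPlane_le_boundaryTangentSpace _ _ hc₁) hc
    obtain ⟨w, rfl, rfl⟩ := hlift v₁ v₂ (contactPlane_le_boundaryTangentSpace _ _ hv₁) hv
    exact hFω z w₀ w hc₁ hv₁

variable [T2Space W₁] [T2Space W₂]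

/-- **The conformal factor of the seam of a Stein bisection.**  Let `e₁ : W₁ → X`,
`e₂ : W₂ → X` be smooth embeddings of two compact Stein domains whose pushed-forward complex
tangencies agree at common points, `b₁` a boundary datum of `W₁` and `g : b₁.carrier → W₂` a
smooth seam partner of the inclusion (`e₂ ∘ g = e₁ ∘ incl₁`, values in `∂W₂`;
`exists_seamPartner`).  The contact forms pulled back to the boundary `3`-manifold,
`a₁ = incl₁^* α₁` and `a₂ = g^* α₂`, are smooth nowhere-vanishing `1`-forms with the same
kernel (the pulled-back contact structure), hence (`exists_conformalFactor_of_ker_eq`)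
`a₂ = F a₁` for a continuous nowhere-vanishing **conformal factor** `F`, and
`da₂ = F da₁` on pairs of kernel vectors; read back on `W₁`, `W₂` (`dαᵢ = ωᵢ`):
`α₂(dg u) = F · α₁(dincl₁ u)` and `ω₂(dg u, dg v) = F · ω₁(dincl₁ u, dincl₁ v)` for
`dincl₁ u, dincl₁ v ∈ ξ₁`.  Geiges (2008), Def. 2.1.5 (contactomorphisms; `Tψ(ξ₁) = ξ₂` iff
`ψ^*α₂ = f α₁`). [cite: Geiges2008, Def. 2.1.5] -/
theorem exists_seam_conformalFactor (J₁ : SteinStructure W₁) (J₂ : SteinStructure W₂)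
    {e₁ : W₁ → X} {e₂ : W₂ → X} (h1 : Manifold.IsSmoothEmbedding (𝓡∂ 4) (𝓡 4) ∞ e₁)
    (h2 : Manifold.IsSmoothEmbedding (𝓡∂ 4) (𝓡 4) ∞ e₂)
    (hC : ∀ w₁ w₂, e₁ w₁ = e₂ w₂ →
      Submodule.map (mfderiv (𝓡∂ 4) (𝓡 4) e₁ w₁).toLinearMap (contactPlane J₁.J w₁) =
        Submodule.map (mfderiv (𝓡∂ 4) (𝓡 4) e₂ w₂).toLinearMap (contactPlane J₂.J w₂))
    (b₁ : BoundaryData (𝓡∂ 4) W₁ (𝓡 3)) {g : b₁.carrier → W₂} (hg : ContMDiff (𝓡 3) (𝓡∂ 4) ∞ g)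
    (hge : ∀ z, e₂ (g z) = e₁ (b₁.incl z)) (hgb : ∀ z, g z ∈ (𝓡∂ 4).boundary W₂) :
    ∃ F : b₁.carrier → ℝ, Continuous F ∧ (∀ z, F z ≠ 0) ∧
      (∀ (z : b₁.carrier) (u : E3), J₂.contactForm (g z) (mfderiv (𝓡 3) (𝓡∂ 4) g z u) =
        F z * J₁.contactForm (b₁.incl z) (mfderiv (𝓡 3) (𝓡∂ 4) b₁.incl z u)) ∧
      ∀ (z : b₁.carrier) (u v : E3),
        mfderiv (𝓡 3) (𝓡∂ 4) b₁.incl z u ∈ contactPlane J₁.J (b₁.incl z) →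
        mfderiv (𝓡 3) (𝓡∂ 4) b₁.incl z v ∈ contactPlane J₁.J (b₁.incl z) →
        J₂.kahlerForm (g z) (mfderiv (𝓡 3) (𝓡∂ 4) g z u) (mfderiv (𝓡 3) (𝓡∂ 4) g z v) =
          F z * J₁.kahlerForm (b₁.incl z) (mfderiv (𝓡 3) (𝓡∂ 4) b₁.incl z u)
            (mfderiv (𝓡 3) (𝓡∂ 4) b₁.incl z v) := by
  obtain ⟨ha₁, ha₁v, ha₁d⟩ := liouvilleForm_pullback J₁ b₁.isSmoothEmbedding.contMDiff
  obtain ⟨ha₂, ha₂v, ha₂d⟩ := liouvilleForm_pullback J₂ hg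
  -- the chain rule along `e₂ ∘ g = e₁ ∘ incl₁`
  have hchain : ∀ (z : b₁.carrier) (u : E3),
      mfderiv (𝓡∂ 4) (𝓡 4) e₁ (b₁.incl z) (mfderiv (𝓡 3) (𝓡∂ 4) b₁.incl z u) =
        mfderiv (𝓡∂ 4) (𝓡 4) e₂ (g z) (mfderiv (𝓡 3) (𝓡∂ 4) g z u) := by
    intro z u
    have hi : MDifferentiableAt (𝓡 3) (𝓡∂ 4) b₁.incl z :=
      b₁.isSmoothEmbedding.contMDiff.mdifferentiableAt (by simp)
    have hgd : MDifferentiableAt (𝓡 3) (𝓡∂ 4) g z := hg.mdifferentiableAt (by simp)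
    have he₁ : MDifferentiableAt (𝓡∂ 4) (𝓡 4) e₁ (b₁.incl z) :=
      h1.contMDiff.mdifferentiableAt (by simp)
    have he₂ : MDifferentiableAt (𝓡∂ 4) (𝓡 4) e₂ (g z) := h2.contMDiff.mdifferentiableAt (by simp)
    have hcomp : e₁ ∘ b₁.incl = e₂ ∘ g := funext fun z => (hge z).symm
    rw [← mfderiv_comp_apply z he₁ hi u, hcomp]
    exact mfderiv_comp_apply z he₂ hgd u
  have hinj : ∀ z : b₁.carrier, Injective (mfderiv (𝓡∂ 4) (𝓡 4) e₁ (b₁.incl z)) ∧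
      Injective (mfderiv (𝓡∂ 4) (𝓡 4) e₂ (g z)) := fun z =>
    ⟨Manifold.IsImmersionAt.mfderiv_injective (h1.isImmersion.isImmersionAt _) (by simp),
      Manifold.IsImmersionAt.mfderiv_injective (h2.isImmersion.isImmersionAt _) (by simp)⟩
  have hb₁ : ∀ z : b₁.carrier, (𝓡∂ 4).IsBoundaryPoint (b₁.incl z) := b₁.incl_mem_boundary
  -- matched vectors: `dincl₁ u ∈ ξ₁ ↔ dg u ∈ ξ₂`
  have hξ : ∀ (z : b₁.carrier) (u : E3),
      mfderiv (𝓡 3) (𝓡∂ 4) b₁.incl z u ∈ contactPlane J₁.J (b₁.incl z) ↔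
        mfderiv (𝓡 3) (𝓡∂ 4) g z u ∈ contactPlane J₂.J (g z) := fun z u =>
    mem_contactPlane_iff_of_seamMatching J₁ J₂ (hC _ _ (hge z).symm) (hinj z).1 (hinj z).2
      (hchain z u)
  -- the two pulled-back contact forms have the same kernel
  have hker : ∀ (z : b₁.carrier) (u : E3),
      (-dComplex J₁.J J₁.φ).pullback (𝓡 3) b₁.incl z ![u] = 0 ↔
        (-dComplex J₂.J J₂.φ).pullback (𝓡 3) g z ![u] = 0 := by
    intro z u
    rw [ha₁v, ha₂v]
    constructor
    · intro h
      have hm : mfderiv (𝓡 3) (𝓡∂ 4) b₁.incl z u ∈ contactPlane J₁.J (b₁.incl z) :=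
        J₁.mem_contactPlane_of_contactForm_eq_zero (hb₁ z)
          (mfderiv_apply_mem_boundaryTangentSpace b₁.incl (hb₁ z) u) h
      exact J₂.contactForm_apply_eq_zero (hgb z) ((hξ z u).1 hm)
    · intro h
      have hm : mfderiv (𝓡 3) (𝓡∂ 4) g z u ∈ contactPlane J₂.J (g z) :=
        J₂.mem_contactPlane_of_contactForm_eq_zero (hgb z)
          (mfderiv_apply_mem_boundaryTangentSpace g (hgb z) u) h
      exact J₁.contactForm_apply_eq_zero (hb₁ z) ((hξ z u).2 hm)
  -- and the first does not vanish
  have hne : ∀ z : b₁.carrier, ∃ u : E3, (-dComplex J₁.J J₁.φ).pullback (𝓡 3) b₁.incl z ![u] ≠ 0 := by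
    intro z
    obtain ⟨v, hv, hαv⟩ := J₁.exists_contactForm_ne_zero (hb₁ z)
    obtain ⟨u, hu⟩ := exists_mfderiv_incl_eq b₁ z hv
    refine ⟨u, ?_⟩
    rw [ha₁v, hu]
    exact hαv
  obtain ⟨F, hFc, hF0, hFa, hFd⟩ := exists_conformalFactor_of_ker_eq ha₁ ha₂ hker hne
  refine ⟨F, hFc, hF0, fun z u => ?_, fun z u v hu hv => ?_⟩
  · rw [← ha₁v, ← ha₂v]
    exact hFa z _
  · rw [← ha₁d, ← ha₂d]
    refine hFd z u v ?_ ?_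
    · rw [ha₁v]
      exact J₁.contactForm_apply_eq_zero (hb₁ z) hu
    · rw [ha₁v]
      exact J₁.contactForm_apply_eq_zero (hb₁ z) hv

end Seam

/-! ### The twisting number is invariant under seam transport -/

/-- **The twisting number of a framed Legendrian knot is invariant under the seam transport of a
two-sided Stein bisection.**  Let a closed `4`-manifold `X` be bisected into two compact Stein
domains, `X = e₁(W₁) ∪ e₂(W₂)`, the images meeting exactly along the images of both boundaries,
with the pushed-forward complex tangencies `deᵢ(ξᵢ)` agreeing at common points.  If `Λ ⊂ ∂W₁`
and `β ⊂ ∂W₂` are Legendrian knots with `e₁ ∘ Λ = e₂ ∘ β` and `ν₁`, `ν₂` framings with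
`de₁ ν₁ = de₂ ν₂`, then `twisting Λ ν₁ = twisting β ν₂`: the twisting number of a framing
relative to the canonical (contact) framing (Gompf 1998, §1; Geiges 2008, Def. 3.5.4) is a
contact invariant.  Proof: on the boundary `3`-manifold of `W₁` (`nonempty_boundaryData_holds`)
the seam partner `g` of the inclusion (`exists_seamPartner`) yields the conformal factor `F` of
`exists_seam_conformalFactor` (`g^*α₂ = F · incl₁^*α₁`, `g^*ω₂ = F · incl₁^*ω₁` on kernel
pairs); along the knot `F` has constant sign (intermediate value theorem), and
`twisting_eq_of_seamTransport_of_conformalFactor` (`SteinSeamConformal.lean`) concludes.  The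
cover hypothesis is not used. [cite: Gompf1998, §1] -/
theorem twisting_eq_of_seamTransport :
    ∀ (X : Type) [TopologicalSpace X] [T2Space X] [SecondCountableTopology X] [CompactSpace X]
      [ChartedSpace (EuclideanSpace ℝ (Fin 4)) X] [IsManifold (𝓡 4) ∞ X]
      (W₁ : Type) [TopologicalSpace W₁] [ChartedSpace (EuclideanHalfSpace 4) W₁]
      [IsManifold (𝓡∂ 4) ∞ W₁] [CompactSpace W₁]
      (W₂ : Type) [TopologicalSpace W₂] [ChartedSpace (EuclideanHalfSpace 4) W₂]
      [IsManifold (𝓡∂ 4) ∞ W₂] [CompactSpace W₂]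
      (J₁ : SteinStructure W₁) (J₂ : SteinStructure W₂) (e₁ : W₁ → X) (e₂ : W₂ → X),
      Manifold.IsSmoothEmbedding (𝓡∂ 4) (𝓡 4) ∞ e₁ → Manifold.IsSmoothEmbedding (𝓡∂ 4) (𝓡 4) ∞ e₂ →
      range e₁ ∪ range e₂ = univ →
      range e₁ ∩ range e₂ = e₁ '' (𝓡∂ 4).boundary W₁ →
      range e₁ ∩ range e₂ = e₂ '' (𝓡∂ 4).boundary W₂ →
      (∀ w₁ w₂, e₁ w₁ = e₂ w₂ →
        Submodule.map (mfderiv (𝓡∂ 4) (𝓡 4) e₁ w₁).toLinearMap (contactPlane J₁.J w₁) =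
          Submodule.map (mfderiv (𝓡∂ 4) (𝓡 4) e₂ w₂).toLinearMap (contactPlane J₂.J w₂)) →
      ∀ (Λ : 𝕊 1 → W₁) (β : 𝕊 1 → W₂) (ν₁ ν₂ : 𝕊 1 → E4),
        IsLegendrianKnot J₁.J Λ → IsLegendrianKnot J₂.J β → (∀ u, e₁ (Λ u) = e₂ (β u)) →
        IsKnotFraming Λ ν₁ → IsKnotFraming β ν₂ →
        (∀ u, mfderiv (𝓡∂ 4) (𝓡 4) e₁ (Λ u) (ν₁ u) = mfderiv (𝓡∂ 4) (𝓡 4) e₂ (β u) (ν₂ u)) →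
        J₁.twisting Λ ν₁ = J₂.twisting β ν₂ := by
  intro X _ _ _ _ _ _ W₁ _ _ _ _ W₂ _ _ _ _ J₁ J₂ e₁ e₂ h1 h2 _ hL hR hC Λ β ν₁ ν₂ hΛ hβ hΛβ hν₁ hν₂
    hν
  haveI : T2Space W₁ := h1.isEmbedding.t2Space
  haveI : T2Space W₂ := h2.isEmbedding.t2Space
  haveI : SecondCountableTopology W₁ := h1.isEmbedding.secondCountableTopology
  obtain ⟨b₁⟩ := nonempty_boundaryData_holds 3 W₁
  obtain ⟨g, hg, hge, hgb⟩ := exists_seamPartner h1 h2 hL hR b₁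
  obtain ⟨F, hFc, hF0, hFα, hFω⟩ := exists_seam_conformalFactor J₁ J₂ h1 h2 hC b₁ hg hge hgb
  -- lift the knot to the boundary manifold
  have hex : ∀ t : ℝ, ∃ z : b₁.carrier, b₁.incl z = Λ (circlePt t) := fun t => by
    rw [← mem_range, b₁.range_incl]
    exact hΛ.isBoundaryPoint _
  choose z hz using hex
  have hgz : ∀ t, g (z t) = β (circlePt t) := fun t =>
    h2.isEmbedding.injective (by rw [hge, hz, hΛβ])
  -- the conformal factor along the knot has constant sign
  have hzc : Continuous z := by
    rw [b₁.isSmoothEmbedding.isEmbedding.continuous_iff]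
    have h : b₁.incl ∘ z = fun t => Λ (circlePt t) := funext hz
    rw [h]
    exact hΛ.isSmoothEmbedding.isEmbedding.continuous.comp continuous_circlePt
  set f : ℝ → ℝ := fun t => F (z t) with hf_def
  have hfc : Continuous f := hFc.comp hzc
  have hf0 : ∀ t, f t ≠ 0 := fun t => hF0 (z t)
  have hf : (∀ t, 0 < f t) ∨ (∀ t, f t < 0) := by
    by_cases h0 : 0 < f 0
    · refine Or.inl fun t => ?_
      by_contra hle
      push Not at hle
      obtain ⟨s, hs⟩ := intermediate_value_univ t 0 hfc ⟨hle, h0.le⟩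
      exact hf0 s hs
    · have h0' : f 0 < 0 := lt_of_le_of_ne (not_lt.1 h0) (hf0 0)
      refine Or.inr fun t => ?_
      by_contra hle
      push Not at hle
      obtain ⟨s, hs⟩ := intermediate_value_univ 0 t hfc ⟨h0'.le, hle⟩
      exact hf0 s hs
  -- the velocities correspond under the differentials
  have hvel : ∀ t : ℝ, mfderiv (𝓡∂ 4) (𝓡 4) e₁ (Λ (circlePt t)) (knotVelocity Λ t) =
      mfderiv (𝓡∂ 4) (𝓡 4) e₂ (β (circlePt t)) (knotVelocity β t) := by
    intro t
    have hΛc : MDifferentiableAt 𝓘(ℝ, ℝ) (𝓡∂ 4) (Λ ∘ circlePt) t :=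
      ((hΛ.isSmoothEmbedding.contMDiff.comp contMDiff_circlePt) t).mdifferentiableAt (by simp)
    have hβc : MDifferentiableAt 𝓘(ℝ, ℝ) (𝓡∂ 4) (β ∘ circlePt) t :=
      ((hβ.isSmoothEmbedding.contMDiff.comp contMDiff_circlePt) t).mdifferentiableAt (by simp)
    have he₁ : MDifferentiableAt (𝓡∂ 4) (𝓡 4) e₁ ((Λ ∘ circlePt) t) :=
      h1.contMDiff.mdifferentiableAt (by simp)
    have he₂ : MDifferentiableAt (𝓡∂ 4) (𝓡 4) e₂ ((β ∘ circlePt) t) :=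
      h2.contMDiff.mdifferentiableAt (by simp)
    have hfun : e₁ ∘ (Λ ∘ circlePt) = e₂ ∘ (β ∘ circlePt) := funext fun s => hΛβ (circlePt s)
    show mfderiv (𝓡∂ 4) (𝓡 4) e₁ ((Λ ∘ circlePt) t)
        (mfderiv 𝓘(ℝ, ℝ) (𝓡∂ 4) (Λ ∘ circlePt) t (1 : ℝ)) =
      mfderiv (𝓡∂ 4) (𝓡 4) e₂ ((β ∘ circlePt) t) (mfderiv 𝓘(ℝ, ℝ) (𝓡∂ 4) (β ∘ circlePt) t (1 : ℝ))
    rw [← mfderiv_comp_apply t he₁ hΛc (1 : ℝ), ← mfderiv_comp_apply t he₂ hβc (1 : ℝ), hfun]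
  -- conclude by the conformal-factor reduction
  refine twisting_eq_of_seamTransport_of_conformalFactor J₁ J₂ hΛ hβ hν₁ hν₂ hν f hf
    (fun t u₁ u₂ hu₁ _ hu => ?_) (fun t v₁ v₂ hv₁ _ hv => ?_)
  · exact (seam_transport_apply J₁ J₂ h1 h2 b₁ hg hge hFα hFω (z t) (hz t) (hgz t)).1 u₁ u₂ hu₁ hu
  · exact (seam_transport_apply J₁ J₂ h1 h2 b₁ hg hge hFα hFω (z t) (hz t) (hgz t)).2 _ _ v₁ v₂
      (hΛ.knotVelocity_mem t) hv₁ (hvel t) hv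

end Literature.Geometry.Symplectic

end
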